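import Summits.ResolutionOfSingularities.ResolutionOfSingularities.Theorems.HomologicalConductorNoZenoRQuadraticTransformNonContracted
import Literature.AlgebraicGeometry.Resolution.ExceptionalCurvesLocalizedResolution
import HarnessLib

/-!
# Crux `NoZenoR` (stmt-ResolutionOfSingularities-19943) — the COUNT DROP of the localisation step: over the image point of
# a first-kind curve lie strictly FEWER integral exceptional curves than the desingularization has

Route `ResolutionOfSingularities/HomologicalConductor` (cell decomp-res, hand leafhand-res-homologicalconduct-24 g0).
OURS: AI-written bookkeeping over tree theorems, weaker than expert review; nothing here is a statement of the
manuscript under review (Hironaka 2017).  SUPPORT level, counted 0.  Def-free, fact-free.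

* **`ncard_excCurvePoints_over_lt_of_firstKind`** — `S` rational non-regular, `π : X → Spec S` a desingularization,
  `b : V → Spec S` a blowing up of `𝔪`, `σ : X → V` proper with `σ ≫ b = π`, `E_η` of the first kind: the integral
  exceptional curves `E_ζ` of `π` with `σ ζ = σ η` form a PROPER subset of `excCurvePoints π`, of strictly smaller
  cardinality — `σ η` is closed (`isClosed_singleton_apply_of_firstKind`) while some curve has `σ η′` non-closed
  (`exists_mem_excCurvePoints_not_isClosed_apply`); `excCurvePoints π` is finite (`IsResolution.excCurvePoints_finite`).

This is the inequality `(excCurvePoints π₁).ncard < (excCurvePoints π).ncard` of the hypothesis `hstep` of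
`…MinimalNoFirstKindOfStep`, once the germ dictionary `excCurvePoints π₁ ≃ {ζ ∈ excCurvePoints π | σ ζ = σ η}` ([B],
tree `ExcCount.excCurvePoints_pullback_snd_localization` over the affine chart) is in place.
No crux or summit statement is proved here.
-/

noncomputable section

-- single-problem summit: the doubled namespace component `ResolutionOfSingularities` is forced
set_option linter.dupNamespace false

open CategoryTheory CategoryTheory.Limits AlgebraicGeometry TopologicalSpace IsLocalRing
open Literature.AlgebraicGeometry Literature.AlgebraicGeometry.Resolution

namespace Summit.ResolutionOfSingularities.ResolutionOfSingularities.Theorems.NoZeno.FirstKind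

variable {S : Type} [CommRing S] [IsNoetherianRing S] [IsLocalRing S] [IsDomain S] [IsIntegrallyClosed S]
  {X : Scheme.{0}} [IsIntegral X] [IsLocallyNoetherian X] (π : X ⟶ Spec (.of S))

/-- **Count drop.**  With `S` rational non-regular, `π = σ ≫ b` a desingularization dominating a blowing up `b` of
`𝔪`, `σ` proper, and `E_η` of the first kind: the curves of `π` over the (closed) point `σ η` are a proper subset of
`excCurvePoints π`, so `#{ζ ∈ excCurvePoints π | σ ζ = σ η} < #excCurvePoints π`.
[cite: Lipman1969, Lemma (14.1) (p. 224); Section 2, (*) (p. 203)] -/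
theorem ncard_excCurvePoints_over_lt_of_firstKind (hdim : ringKrullDim S = 2) (hrat : HasRationalSingularity S)
    (hsing : ¬ IsRegularLocalRing S) (hπ : IsResolution π) {V : Scheme.{0}} {b : V ⟶ Spec (.of S)}
    (hb : IsBlowup b (affineBlowup.idealSheaf (maximalIdeal S))) (σ : X ⟶ V) [IsProper σ] (hσ : σ ≫ b = π)
    {η : X} (hη : η ∈ excCurvePoints π)
    (hfk : h0 π (primeDivisorIdeal η ^ 2) = 3 * h0 π (primeDivisorIdeal η)) :
    {ζ ∈ excCurvePoints π | σ.base ζ = σ.base η}.ncard < (excCurvePoints π).ncard := by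
  refine Set.ncard_lt_ncard ?_ (IsResolution.excCurvePoints_finite hdim hπ)
  refine ⟨fun ζ hζ => hζ.1, fun hsub => ?_⟩
  obtain ⟨η', hη', hncl⟩ := exists_mem_excCurvePoints_not_isClosed_apply π hdim hrat hsing hπ hb σ hσ
  have hcl := isClosed_singleton_apply_of_firstKind π hdim hrat hsing hπ hb σ hσ hη hfk
  have heq : σ.base η' = σ.base η := (hsub hη').2
  rw [heq] at hncl
  exact hncl hcl

end Summit.ResolutionOfSingularities.ResolutionOfSingularities.Theorems.NoZeno.FirstKind

end
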